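import Summits.Ventures.CertifiedManyBodySolver.Transport.TorusBoxFourier
import HarnessLib

/-!
# Ventures/CertifiedManyBodySolver — Transport/PauliMarkovMatrixFourier.lean

HONEST FRAMING: first certified bounds; not a superconductivity verdict; every number certified or labelled float.

Fourier half of LEMMA PMP / LEMMA PM-2D (op-02, `HOME/op/PM-2D.md` §2 and §7.4; the state half is
`Transport/PauliMarkovMatrix.lean`; box, characters, orthogonality and the pair count are
`Transport/TorusBoxFourier.lean`): Fejér means on the `d`-torus of a MATRIX-valued lattice sequence, for
GENUINE `ℤ^d` frequencies (the one-direction scalar case is `Transport/PauliMarkovFourier.lean`).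

* for a sequence `G : ℤ^d → M_J(ℂ)` its Fejér mean
  `M_W(k) = W^{-d} Σ_{x,y ∈ [0,W)^d} e^{ik·(y−x)} G(y − x)` (`fejerMatrix`), for a finitely supported
  coefficient family `Λ` its symbol `Λ̂(k) = Σ_{r ∈ S} e^{−ik·r} Λ_r` (`matrixSymbol`), and the identity
  `(2π)^{-d} ∫ tr(Λ̂(k) M_W(k)) dk = Σ_{r ∈ S} w_W(r) tr(Λ_r G(r))` with the Fejér weights
  `w_W(r) = Π_i (1 − |r_i|/W) → 1` (`integral_trace_matrixSymbol_mul_fejerMatrix`, `tendsto_fejerWeight`);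
* the ABSTRACT MAJORANT THEOREM `sum_re_trace_le_integral_of_fejerMatrix`: if every Fejér mean
  `M_W(k)` (`W ≥ 1`, `k` in the box) has a property `P` and `u` is integrable on the box with
  `Re tr(Λ̂(k) M) ≤ u(k)` for all `M` with `P M`, then `Σ_{r∈S} Re tr(Λ_r G(r)) ≤ (2π)^{-d} ∫ u`.
  (For the fermionic two-letter family, `P M ⇔ 0 ⪯ M ⪯ C(ν)`, this is Lemma PMP; for the `1 × 1` corner
  and `P = [0, 1]` it is Lemma PM-2D / PM-ℤ^d.)

Pure real analysis (Mathlib: `MeasureTheory.integral_finsetSum`, `setIntegral_mono_on`, `le_of_tendsto'`);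
no states, no physical notion, no named fact, no sorry.

References: op-02 PM-2D.md §2 (Lemma PM-2D), §7.4 (PMP body `0 ⪯ M(k) ⪯ C(ρ)`); M. Bakonyi, H. J. Woerdeman,
*Matrix Completions, Moments, and Sums of Hermitian Squares* (Princeton UP 2011) §1.3/§3.1 (Fejér means of
positive-definite operator-valued sequences on `ℤ^d`) — only the elementary finite-window argument is used.
-/

noncomputable section

namespace Summit.Ventures.CertifiedManyBodySolver.Transport

open Matrix Finset MeasureTheory
open Literature.Probability.LatticeModels
open Literature.MathematicalPhysics.QuantumLattice
open scoped ComplexOrder Real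

variable {d : ℕ}

/-! ### §3. Fejér means of a matrix sequence, the symbol, and the Fejér weights -/

section Fejer

variable {J : Type*}

/-- **The Fejér mean** of a matrix sequence `G : ℤ^d → M_J(ℂ)` over the window `[0, W)^d`:
`M_W(k) = W^{-d} Σ_{x,y ∈ [0,W)^d} e^{ik·(y−x)} G(y − x)`. -/
def fejerMatrix (G : Site d → Matrix J J ℂ) (W : ℕ) (k : Fin d → ℝ) : Matrix J J ℂ :=
  ((W : ℂ) ^ d)⁻¹ • ∑ x : Fin d → Fin W, ∑ y : Fin d → Fin W,
    boxChar (boxSite W y - boxSite W x) k • G (boxSite W y - boxSite W x)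

/-- **The symbol** `Λ̂(k) = Σ_{r ∈ S} e^{−ik·r} Λ_r` of a coefficient family `Λ` with support `S`. -/
def matrixSymbol (S : Finset (Site d)) (Lam : Site d → Matrix J J ℂ) (k : Fin d → ℝ) : Matrix J J ℂ :=
  ∑ r ∈ S, boxChar (-r) k • Lam r

/-- **The Fejér weight** `w_W(r) = W^{-d} Π_i (W − |r_i|)₊` (`= Π_i (1 − |r_i|/W)` once `W ≥ |r_i|`). -/
def fejerWeight (W : ℕ) (r : Site d) : ℝ := ((W : ℝ) ^ d)⁻¹ * ∏ i, ((W - (r i).natAbs : ℕ) : ℝ)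

/-- The symbol is continuous in `k`. -/
theorem continuous_matrixSymbol (S : Finset (Site d)) (Lam : Site d → Matrix J J ℂ) :
    Continuous (matrixSymbol S Lam) := by
  unfold matrixSymbol
  refine continuous_finsetSum _ fun r _ => ?_
  exact (continuous_boxChar (-r)).smul continuous_const

/-- The Fejér mean is continuous in `k`. -/
theorem continuous_fejerMatrix (G : Site d → Matrix J J ℂ) (W : ℕ) : Continuous (fejerMatrix G W) := by
  have h : Continuous fun k : Fin d → ℝ => ∑ x : Fin d → Fin W, ∑ y : Fin d → Fin W,
      boxChar (boxSite W y - boxSite W x) k • G (boxSite W y - boxSite W x) :=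
    continuous_finsetSum _ fun x _ => continuous_finsetSum _ fun y _ =>
      (continuous_boxChar _).smul continuous_const
  exact h.const_smul (((W : ℂ) ^ d)⁻¹)

/-- Entries of the symbol: `Λ̂(k)_{ab} = Σ_r χ_{−r}(k) (Λ_r)_{ab}`. -/
theorem matrixSymbol_apply (S : Finset (Site d)) (Lam : Site d → Matrix J J ℂ) (k : Fin d → ℝ) (a b : J) :
    matrixSymbol S Lam k a b = ∑ r ∈ S, boxChar (-r) k * Lam r a b := by
  simp [matrixSymbol, Matrix.sum_apply]

section Trace

variable [Fintype J]

/-- **Trace pairing, pointwise**: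
`tr(Λ̂(k) M_W(k)) = W^{-d} Σ_{r∈S} Σ_{x,y} χ_{y−x−r}(k) tr(Λ_r G(y−x))`. -/
theorem trace_matrixSymbol_mul_fejerMatrix (G : Site d → Matrix J J ℂ) (S : Finset (Site d))
    (Lam : Site d → Matrix J J ℂ) (W : ℕ) (k : Fin d → ℝ) :
    (matrixSymbol S Lam k * fejerMatrix G W k).trace =
      ((W : ℂ) ^ d)⁻¹ * ∑ r ∈ S, ∑ x : Fin d → Fin W, ∑ y : Fin d → Fin W,
        boxChar (boxSite W y - boxSite W x - r) k * (Lam r * G (boxSite W y - boxSite W x)).trace := by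
  simp only [matrixSymbol, fejerMatrix, Finset.sum_mul, Matrix.mul_smul, Matrix.smul_mul,
    Matrix.trace_sum, Matrix.trace_smul, smul_eq_mul, Finset.mul_sum]
  refine Finset.sum_congr rfl fun r _ => Finset.sum_congr rfl fun x _ => Finset.sum_congr rfl fun y _ => ?_
  rw [boxChar_sub (boxSite W y - boxSite W x) r k]
  ring

/-- **Trace pairing, integrated**:
`∫_{(0,2π]^d} tr(Λ̂(k) M_W(k)) dk = (2π)^d Σ_{r∈S} w_W(r) tr(Λ_r G(r))`. -/
theorem integral_trace_matrixSymbol_mul_fejerMatrix (G : Site d → Matrix J J ℂ) (S : Finset (Site d))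
    (Lam : Site d → Matrix J J ℂ) (W : ℕ) :
    ∫ k in torusBox d, (matrixSymbol S Lam k * fejerMatrix G W k).trace =
      (2 * (π : ℂ)) ^ d * ∑ r ∈ S, ((fejerWeight W r : ℝ) : ℂ) * (Lam r * G r).trace := by
  simp_rw [trace_matrixSymbol_mul_fejerMatrix]
  have hint : ∀ (m : Site d) (c : ℂ), Integrable (fun k : Fin d → ℝ => boxChar m k * c)
      ((volume : Measure (Fin d → ℝ)).restrict (torusBox d)) := fun m c =>
    integrableOn_torusBox_of_continuous ((continuous_boxChar m).mul continuous_const)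
  have hint_y : ∀ (r : Site d) (x : Fin d → Fin W), Integrable (fun k : Fin d → ℝ => ∑ y : Fin d → Fin W,
      boxChar (boxSite W y - boxSite W x - r) k * (Lam r * G (boxSite W y - boxSite W x)).trace)
      ((volume : Measure (Fin d → ℝ)).restrict (torusBox d)) := fun r x =>
    integrable_finsetSum _ fun y _ => hint _ _
  have hint_x : ∀ r : Site d, Integrable (fun k : Fin d → ℝ => ∑ x : Fin d → Fin W, ∑ y : Fin d → Fin W,
      boxChar (boxSite W y - boxSite W x - r) k * (Lam r * G (boxSite W y - boxSite W x)).trace)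
      ((volume : Measure (Fin d → ℝ)).restrict (torusBox d)) := fun r =>
    integrable_finsetSum _ fun x _ => hint_y r x
  rw [MeasureTheory.integral_const_mul, MeasureTheory.integral_finsetSum _ (fun r _ => hint_x r)]
  simp_rw [MeasureTheory.integral_finsetSum _ (fun x _ => hint_y _ x),
    MeasureTheory.integral_finsetSum _ (fun y _ => hint _ _), MeasureTheory.integral_mul_const,
    integral_torusBox_boxChar, sub_eq_zero]
  -- `[y - x = r] (2π)^d tr(Λ_r G(y−x)) = [y − x = r] ((2π)^d tr(Λ_r G(r)))`
  have hterm : ∀ (r : Site d) (x y : Fin d → Fin W),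
      (if boxSite W y - boxSite W x = r then (2 * (π : ℂ)) ^ d else 0) *
          (Lam r * G (boxSite W y - boxSite W x)).trace =
        if boxSite W y - boxSite W x = r then (2 * (π : ℂ)) ^ d * (Lam r * G r).trace else 0 := by
    intro r x y
    split_ifs with h
    · rw [h]
    · rw [zero_mul]
  simp_rw [hterm, sum_boxSite_ite_sub_eq]
  rw [Finset.mul_sum, Finset.mul_sum]
  refine Finset.sum_congr rfl fun r _ => ?_
  unfold fejerWeight
  push_cast
  ring

/-- For `W ≥ |r_i|` (all `i`) and `W ≥ 1`: `w_W(r) = Π_i (1 − |r_i|/W)`. -/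
theorem fejerWeight_eq_prod {W : ℕ} (hW : 0 < W) (r : Site d) (hr : ∀ i, (r i).natAbs ≤ W) :
    fejerWeight W r = ∏ i, (1 - ((r i).natAbs : ℝ) / W) := by
  unfold fejerWeight
  have hW' : (W : ℝ) ≠ 0 := by exact_mod_cast hW.ne'
  rw [show ((W : ℝ) ^ d)⁻¹ = ∏ _i : Fin d, (W : ℝ)⁻¹ by
    rw [Finset.prod_const, Finset.card_univ, Fintype.card_fin, inv_pow], ← Finset.prod_mul_distrib]
  refine Finset.prod_congr rfl fun i _ => ?_
  rw [Nat.cast_sub (hr i)]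
  field_simp

/-- **`w_W(r) → 1`** as `W → ∞`, for each fixed frequency `r`. -/
theorem tendsto_fejerWeight (r : Site d) :
    Filter.Tendsto (fun W : ℕ => fejerWeight W r) Filter.atTop (nhds 1) := by
  have hev : ∀ᶠ W : ℕ in Filter.atTop, (∏ i, (1 - ((r i).natAbs : ℝ) / W)) = fejerWeight W r := by
    filter_upwards [Filter.eventually_ge_atTop (1 + ∑ i, (r i).natAbs)] with W hW
    refine (fejerWeight_eq_prod (by omega) r fun i => ?_).symm
    have : (r i).natAbs ≤ ∑ j, (r j).natAbs :=
      Finset.single_le_sum (f := fun j => (r j).natAbs) (fun j _ => Nat.zero_le _) (Finset.mem_univ i)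
    omega
  refine Filter.Tendsto.congr' hev ?_
  have h1 : (1 : ℝ) = ∏ _i : Fin d, (1 : ℝ) := by simp
  rw [h1]
  refine tendsto_finsetProd _ fun i _ => ?_
  have h := tendsto_const_div_atTop_nhds_zero_nat ((r i).natAbs : ℝ)
  simpa using (tendsto_const_nhds (x := (1 : ℝ))).sub h

/-- The real damped row `Σ_{r∈S} w_W(r) Re tr(Λ_r G(r))` converges to the row `Σ_{r∈S} Re tr(Λ_r G(r))`. -/
theorem tendsto_dampedRow (G : Site d → Matrix J J ℂ) (S : Finset (Site d)) (Lam : Site d → Matrix J J ℂ) :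
    Filter.Tendsto (fun W : ℕ => ∑ r ∈ S, fejerWeight W r * ((Lam r * G r).trace).re) Filter.atTop
      (nhds (∑ r ∈ S, ((Lam r * G r).trace).re)) := by
  refine tendsto_finsetSum _ fun r _ => ?_
  simpa using (tendsto_fejerWeight r).mul_const ((Lam r * G r).trace).re

/-! ### §4. The abstract majorant theorem -/

/-- **The damped row as a torus integral** (real part of `integral_trace_matrixSymbol_mul_fejerMatrix`):
`(2π)^{-d} ∫ Re tr(Λ̂(k) M_W(k)) dk = Σ_{r∈S} w_W(r) Re tr(Λ_r G(r))`. -/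
theorem integral_re_trace_matrixSymbol_mul_fejerMatrix (G : Site d → Matrix J J ℂ) (S : Finset (Site d))
    (Lam : Site d → Matrix J J ℂ) (W : ℕ) :
    ((2 * π) ^ d)⁻¹ * ∫ k in torusBox d, ((matrixSymbol S Lam k * fejerMatrix G W k).trace).re =
      ∑ r ∈ S, fejerWeight W r * ((Lam r * G r).trace).re := by
  have hcont : Continuous fun k : Fin d → ℝ => (matrixSymbol S Lam k * fejerMatrix G W k).trace :=
    ((continuous_matrixSymbol S Lam).mul (continuous_fejerMatrix G W)).matrix_trace
  have hre := Complex.reCLM.integral_comp_comm (integrableOn_torusBox_of_continuous (d := d) hcont)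
  simp only [Complex.reCLM_apply] at hre
  rw [hre, integral_trace_matrixSymbol_mul_fejerMatrix]
  have h2π : ((2 * (π : ℂ)) ^ d * ∑ r ∈ S, ((fejerWeight W r : ℝ) : ℂ) * (Lam r * G r).trace).re =
      (2 * π) ^ d * ∑ r ∈ S, fejerWeight W r * ((Lam r * G r).trace).re := by
    rw [show (2 * (π : ℂ)) ^ d = (((2 * π) ^ d : ℝ) : ℂ) by push_cast; ring, Complex.re_ofReal_mul,
      Complex.re_sum]
    congr 1
    refine Finset.sum_congr rfl fun r _ => ?_
    rw [Complex.re_ofReal_mul]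
  rw [h2π, ← mul_assoc, inv_mul_cancel₀ (by positivity), one_mul]

/-- **ABSTRACT MAJORANT THEOREM (Fejér / Pauli–Markov mechanism).** Let `G : ℤ^d → M_J(ℂ)` be a matrix
sequence all of whose Fejér means `M_W(k)` (`W ≥ 1`, `k ∈ (0,2π]^d`) satisfy a property `P`, and let
`u` be integrable on the box with `Re tr(Λ̂(k) M) ≤ u(k)` for every `k` in the box and every `M` with
`P M`. Then the row `Σ_{r∈S} Re tr(Λ_r G(r))` is at most `(2π)^{-d} ∫_{(0,2π]^d} u`. -/
theorem sum_re_trace_le_integral_of_fejerMatrix (G : Site d → Matrix J J ℂ) (P : Matrix J J ℂ → Prop)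
    (hP : ∀ W : ℕ, 0 < W → ∀ k ∈ torusBox d, P (fejerMatrix G W k))
    (S : Finset (Site d)) (Lam : Site d → Matrix J J ℂ) (u : (Fin d → ℝ) → ℝ)
    (hu : IntegrableOn u (torusBox d))
    (hmaj : ∀ k ∈ torusBox d, ∀ M : Matrix J J ℂ, P M → ((matrixSymbol S Lam k * M).trace).re ≤ u k) :
    ∑ r ∈ S, ((Lam r * G r).trace).re ≤ ((2 * π) ^ d)⁻¹ * ∫ k in torusBox d, u k := by
  -- every damped row is bounded by the integral of the majorant
  have hle : ∀ n : ℕ, ∑ r ∈ S, fejerWeight (n + 1) r * ((Lam r * G r).trace).re ≤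
      ((2 * π) ^ d)⁻¹ * ∫ k in torusBox d, u k := by
    intro n
    rw [← integral_re_trace_matrixSymbol_mul_fejerMatrix]
    refine mul_le_mul_of_nonneg_left ?_ (by positivity)
    refine setIntegral_mono_on ?_ hu (measurableSet_torusBox d) fun k hk => ?_
    · have hcont : Continuous fun k : Fin d → ℝ => ((matrixSymbol S Lam k * fejerMatrix G (n + 1) k).trace).re :=
        Complex.continuous_re.comp ((continuous_matrixSymbol S Lam).mul (continuous_fejerMatrix G (n + 1))).matrix_trace
      exact integrableOn_torusBox_of_continuous hcont
    · exact hmaj k hk _ (hP (n + 1) (Nat.succ_pos n) k hk)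
  -- and the damped rows converge to the row
  have hlim := (tendsto_dampedRow G S Lam).comp (Filter.tendsto_add_atTop_nat 1)
  exact le_of_tendsto' hlim hle

end Trace

end Fejer

end Summit.Ventures.CertifiedManyBodySolver.Transport

end
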